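import Mathlib
import Summits.Ventures.PercRepro2.GoodCoordinate

/-!
# The root relabelling with pins: `(B_S □ B_T, B_V)` with `V = S` or `V = T`
(seat mine-b, cell pub-perc-repro2; conjectures/MINE-B.md §15 Addendum 14)

`pinE B S = B (· ∪ S)` is the event `B` with the pins `S` open. The relabelling of StepRoot.lean works
for the pair `(pinE B S □ pinE B T, pinE B V)` whenever the second event carries the pins of one of the two
factors (`V = T`: the `C₁`-witness `L`, with `L ∪ V ∪ i ∈ B`, becomes the `B_T`-witness `L ∪ i` of the
`A₁`-part and the displaced `B_T`-witness becomes the `C₀`-witness; `V = S`: symmetrically): the doubly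
pivotal configurations lie in `E_i`, so EVERY coordinate is good (`cN_le_cE_pinned_right/left`, `good_pinned`; no monotonicity of `B` is needed). This covers the root
`(B □ B, B)` and, at depth 1 of the sectioning tree, the child `((B □ B)(· ∪ i), B) = (B □ B_{i}, B)`
(`V = S = ∅`); the other child `(B □ B, B_{i})` has `V ∉ {S, T}` and needs the other terms of the
surplus (census MINE-B.md §15 Addendum 13: every depth-1 node on 6 elements has a good coordinate).
-/

open Finset

namespace Summit.Ventures.PercRepro2

namespace StepZero

open ReimerCube

variable {E : Type*} [DecidableEq E]

open Classical

/-- the event `B` with the pins `S` open -/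
def pinE (B : Finset E → Prop) (S : Finset E) : Finset E → Prop := fun X => B (X ∪ S)

/-- `pinE B S` is increasing -/
lemma incr_pinE {B : Finset E → Prop} (hB : Incr B) (S : Finset E) : Incr (pinE B S) :=
  fun _ _ hST h => hB (Finset.union_subset_union_left hST) h

/-- **every coordinate is good for `(B_S □ B_T, B_T)`** (the second event carries the pins of the second
factor): `N_i ≤ E_i`. -/
theorem cN_le_cE_pinned_right (U' : Finset E) (B : Finset E → Prop) (S T : Finset E)
    {i : E} (hi : i ∉ U') :
    cN U' (DOcc (pinE B S) (pinE B T)) (pinE B T) i ≤ cE U' (DOcc (pinE B S) (pinE B T)) (pinE B T) i := by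
  unfold cN cE
  apply Finset.card_le_card
  intro γ hγ
  rw [Finset.mem_filter] at hγ ⊢
  obtain ⟨hγU, hX, hnZ, -, hb0⟩ := hγ
  refine ⟨hγU, hX, ?_, hnZ, hb0⟩
  obtain ⟨K, L, hK, hL, hKL, hAK, hCL⟩ := hX
  obtain ⟨KS, KT, hKS, hKT, hKST, hBS, hBT⟩ := hAK K le_rfl
  have hiγ : i ∉ γ := fun h => hi (Finset.mem_powerset.mp hγU h)
  -- `A₁ □ C₀` with the witnesses `KS ∪ L` (for `A₁`: members `KS` for `B_S` and `L ∪ i` for `B_T`)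
  -- and `KT` (for `C₀ = B_T`)
  refine ⟨KS ∪ L, KT, Finset.union_subset (hKS.trans hK) hL, hKT.trans hK, ?_, ?_, hBT⟩
  · rw [Finset.disjoint_union_left]
    exact ⟨hKST, (Finset.disjoint_of_subset_left hKT hKL).symm⟩
  · intro X hX
    have hKSX : KS ⊆ X := (Finset.subset_union_left).trans hX
    have hLX : L ⊆ X := (Finset.subset_union_right).trans hX
    refine ⟨KS, insert i L, hKSX.trans (Finset.subset_insert i X),
      Finset.insert_subset_insert i hLX, ?_, hBS, ?_⟩
    · rw [Finset.disjoint_insert_right]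
      exact ⟨fun h => hiγ (hK (hKS h)), Finset.disjoint_of_subset_left hKS hKL⟩
    · -- every `Y ⊇ insert i L` is a `B_T`-witness: `Y ∪ T ⊇ (L ∪ T) ∪ i`, and `L ∪ T ∪ i ∈ B`
      intro Y hY
      have h1 : L ⊆ Y := (Finset.subset_insert i L).trans hY
      have h2 : pinE B T (insert i Y) := hCL Y h1
      have h3 : insert i Y = Y := Finset.insert_eq_of_mem (hY (Finset.mem_insert_self i L))
      unfold pinE at h2 ⊢
      rwa [h3] at h2

/-- **every coordinate is good for `(B_S □ B_T, B_S)`** (the second event carries the pins of the first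
factor), by symmetry of the disjoint occurrence. -/
theorem cN_le_cE_pinned_left (U' : Finset E) (B : Finset E → Prop) (S T : Finset E)
    {i : E} (hi : i ∉ U') :
    cN U' (DOcc (pinE B S) (pinE B T)) (pinE B S) i ≤ cE U' (DOcc (pinE B S) (pinE B T)) (pinE B S) i := by
  -- `DOcc (pinE B S) (pinE B T) = DOcc (pinE B T) (pinE B S)` pointwise; transport the right-pinned case
  have hcomm : DOcc (pinE B S) (pinE B T) = DOcc (pinE B T) (pinE B S) :=
    funext (fun X => propext ⟨dOcc_comm, dOcc_comm⟩)
  rw [hcomm]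
  exact cN_le_cE_pinned_right U' B T S hi

/-- the pinned root relabelling, as good coordinates -/
theorem good_pinned (U' : Finset E) (B : Finset E → Prop) (S T V : Finset E) {i : E}
    (hi : i ∉ U') (hV : V = S ∨ V = T) :
    cN U' (DOcc (pinE B S) (pinE B T)) (pinE B V) i
      ≤ cD U' (DOcc (pinE B S) (pinE B T)) (pinE B V) i + cE U' (DOcc (pinE B S) (pinE B T)) (pinE B V) i := by
  rcases hV with h | h
  · subst h; exact le_trans (cN_le_cE_pinned_left U' B V T hi) (Nat.le_add_left _ _)
  · subst h; exact le_trans (cN_le_cE_pinned_right U' B S V hi) (Nat.le_add_left _ _)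

end StepZero

end Summit.Ventures.PercRepro2
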